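import Summits.KontsevichZagierPeriods.Zeta5Search.SymmetricFamilyInnerSum
import Summits.KontsevichZagierPeriods.Zeta5Search.SymmetricRecursionCertAtom00
import Summits.KontsevichZagierPeriods.Zeta5Search.SymmetricRecursionCertAtom01
import Summits.KontsevichZagierPeriods.Zeta5Search.SymmetricRecursionCertAtom02
import Summits.KontsevichZagierPeriods.Zeta5Search.SymmetricRecursionCertAtom03
import Summits.KontsevichZagierPeriods.Zeta5Search.SymmetricRecursionCertAtom1011
import Summits.KontsevichZagierPeriods.Zeta5Search.SymmetricRecursionCertAtom1220
import Summits.KontsevichZagierPeriods.Zeta5Search.SymmetricRecursionCertAtom2130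
import Literature.NumberTheory.Irrationality.BrownZudilin2022.TotallySymmetric
import HarnessLib

/-!
# ζ(5) search — the Brown–Zudilin double sum satisfies the third-order recursion: `Q_solvesRec` DISCHARGED (cell `pub-zeta5`, P1)

HONEST FRAMING: systematic search; no irrationality claim unless certified.

Brown–Zudilin, arXiv:2210.03391, Sect. 2: the leading coefficients
`Q_n = Σ_{k ≤ n} C(n+k,n) C(n,k)² Σ_{j ≤ n} C(n+j,n) C(n,j)² C(n+k+j,n)` (eq. (7)) of the totally symmetric
cellular integrals satisfy the recursion `c₃(n)Q_{n+1} - c₂(n)Q_n - c₁(n)Q_{n-1} + c₀(n)Q_{n-2} = 0`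
(`n ≥ 2`). In the source this is a computer verification (Koutschan's `HolonomicFunctions`; no
certificate printed); in the tree it was the NAMED FACT
`Literature.NumberTheory.Irrationality.BrownZudilin2022.Q_solvesRec`, used as a hypothesis by
`Zeta5Search/SymmetricFamilyMargin.lean` and kernel-checked only for `2 ≤ n ≤ 50`
(`SymmetricFamilyCertificates.lean`). This file PROVES it for all `n` (`Q_solvesRec_holds`), by an
explicit two-level creative-telescoping certificate found by the cell:

1. the inner sum `T(n,k)` satisfies the relations (K), (N) of `SymmetricFamilyInnerSum.lean`;
2. with `s(n,k) = C(n,k)² C(n+k,n)` and `C_i = (c₀, -c₁, -c₂, c₃)(n+2)`, for every `n, k`: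
   `Σ_i C_i(n) s(n+i,k) T(n+i,k) = G(n,k+1) - G(n,k)`,
   `G(n,k) = B(n,k)·(gc0·T(n,k) + gc1·T(n,k+1) + gc2·T(n,k+2))/Z(n)`, `B(n,k) = C(n+3,k)² C(n+k,n)`,
   `Z(n) = (n+1)⁴(n+2)⁴(n+3)²` (`telescope_point`; the polynomial bookkeeping is the content of the
   `SymmetricRecursionCert*.lean` files, used through the ten identities `atom_ij`);
3. `G(n,0) = 0` (the `gc`'s are divisible by `k³`) and `G(n,n+4) = 0` (`C(n+3,n+4) = 0`), so summing
   over `0 ≤ k ≤ n+3` gives `Σ_i C_i(n) Q_{n+i} = 0`, i.e. the recursion at index `n+2`.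

No named facts are used; axioms are the standard three.
-/

namespace Summit.KontsevichZagierPeriods.Zeta5Search.SymmetricRecursion

open Finset
open Literature.NumberTheory.Irrationality.BrownZudilin2022

/-! ### The outer weight, the base `B(n,k)` and the normaliser `Z(n)` -/

/-- The outer weight `s(n,k) = C(n,k)² C(n+k,n)` of Brown–Zudilin (7). -/
def outerS (n k : ℕ) : ℚ := ((n.choose k : ℕ) : ℚ) ^ 2 * (((n + k).choose n : ℕ) : ℚ)

/-- The common hypergeometric base `B(n,k) = C(n+3,k)² C(n+k,n)`. -/
def base (n k : ℕ) : ℚ := (((n + 3).choose k : ℕ) : ℚ) ^ 2 * (((n + k).choose n : ℕ) : ℚ)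

/-- The normaliser `Z(n) = (n+1)⁴ (n+2)⁴ (n+3)²`. -/
def Zn (n : ℚ) : ℚ := (n + 1) ^ 4 * (n + 2) ^ 4 * (n + 3) ^ 2

/-- The outer-sum certificate `G(n,k) = B(n,k)·(gc0·T(n,k) + gc1·T(n,k+1) + gc2·T(n,k+2))/Z(n)`. -/
noncomputable def certG (n k : ℕ) : ℚ :=
  base n k * (gc0 n k * innerT n k + gc1 n k * innerT n (k + 1) + gc2 n k * innerT n (k + 2)) / Zn n

/-- `Z(n) ≠ 0`. -/
theorem Zn_ne_zero (n : ℕ) : Zn (n : ℚ) ≠ 0 := by unfold Zn; positivity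

/-! ### Ratio identities: every weight is `B(n,k)` times a polynomial -/

/-- `Z(n)·s(n,k) = B(n,k)·(n+1)²(n+2)²((n+1-k)(n+2-k)(n+3-k))²`. -/
theorem Zn_outerS_zero (n k : ℕ) :
    Zn n * outerS n k = base n k *
      (((n : ℚ) + 1) ^ 2 * ((n : ℚ) + 2) ^ 2 * (((n : ℚ) + 1 - k) * ((n : ℚ) + 2 - k) * ((n : ℚ) + 3 - k)) ^ 2) := by
  have h1 := choose_succ_left_cast n k
  have h2 := choose_succ_left_cast (n + 1) k
  have h3 := choose_succ_left_cast (n + 2) k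
  unfold Zn outerS base
  push_cast at h1 h2 h3 ⊢
  set a0 := ((n.choose k : ℕ) : ℚ)
  set a1 := (((n + 1).choose k : ℕ) : ℚ)
  set a2 := (((n + 2).choose k : ℕ) : ℚ)
  set a3 := (((n + 3).choose k : ℕ) : ℚ)
  set c := (((n + k).choose n : ℕ) : ℚ)
  have e : a0 * (((n : ℚ) + 1) * ((n : ℚ) + 2) * ((n : ℚ) + 3))
      = a3 * (((n : ℚ) + 1 - k) * ((n : ℚ) + 2 - k) * ((n : ℚ) + 3 - k)) := by
    linear_combination (-(((n : ℚ) + 2) * ((n : ℚ) + 3))) * h1 + (-(((n : ℚ) + 1 - k) * ((n : ℚ) + 3))) * h2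
      + (-(((n : ℚ) + 1 - k) * ((n : ℚ) + 2 - k))) * h3
  calc ((n : ℚ) + 1) ^ 4 * ((n : ℚ) + 2) ^ 4 * ((n : ℚ) + 3) ^ 2 * (a0 ^ 2 * c)
      = ((n : ℚ) + 1) ^ 2 * ((n : ℚ) + 2) ^ 2 * c * (a0 * (((n : ℚ) + 1) * ((n : ℚ) + 2) * ((n : ℚ) + 3))) ^ 2 := by
        ring
    _ = ((n : ℚ) + 1) ^ 2 * ((n : ℚ) + 2) ^ 2 * c
          * (a3 * (((n : ℚ) + 1 - k) * ((n : ℚ) + 2 - k) * ((n : ℚ) + 3 - k))) ^ 2 := by rw [e]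
    _ = a3 ^ 2 * c * (((n : ℚ) + 1) ^ 2 * ((n : ℚ) + 2) ^ 2
          * (((n : ℚ) + 1 - k) * ((n : ℚ) + 2 - k) * ((n : ℚ) + 3 - k)) ^ 2) := by ring

/-- `Z(n)·s(n+1,k) = B(n,k)·(n+1)³(n+2)²((n+2-k)(n+3-k))²(n+1+k)`. -/
theorem Zn_outerS_one (n k : ℕ) :
    Zn n * outerS (n + 1) k = base n k *
      (((n : ℚ) + 1) ^ 3 * ((n : ℚ) + 2) ^ 2 * (((n : ℚ) + 2 - k) * ((n : ℚ) + 3 - k)) ^ 2 * ((n : ℚ) + 1 + k)) := by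
  have h2 := choose_succ_left_cast (n + 1) k
  have h3 := choose_succ_left_cast (n + 2) k
  have h4 := choose_add_succ_left_cast n k
  unfold Zn outerS base
  push_cast at h2 h3 h4 ⊢
  rw [show n + 1 + k = n + 1 + k from rfl]
  set a1 := (((n + 1).choose k : ℕ) : ℚ)
  set a2 := (((n + 2).choose k : ℕ) : ℚ)
  set a3 := (((n + 3).choose k : ℕ) : ℚ)
  set c := (((n + k).choose n : ℕ) : ℚ)
  set c1 := (((n + 1 + k).choose (n + 1) : ℕ) : ℚ)
  have e : a1 * (((n : ℚ) + 2) * ((n : ℚ) + 3)) = a3 * (((n : ℚ) + 2 - k) * ((n : ℚ) + 3 - k)) := by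
    linear_combination (-((n : ℚ) + 3)) * h2 + (-((n : ℚ) + 2 - k)) * h3
  calc ((n : ℚ) + 1) ^ 4 * ((n : ℚ) + 2) ^ 4 * ((n : ℚ) + 3) ^ 2 * (a1 ^ 2 * c1)
      = ((n : ℚ) + 1) ^ 3 * ((n : ℚ) + 2) ^ 2 * (a1 * (((n : ℚ) + 2) * ((n : ℚ) + 3))) ^ 2
          * (c1 * ((n : ℚ) + 1)) := by ring
    _ = ((n : ℚ) + 1) ^ 3 * ((n : ℚ) + 2) ^ 2 * (a3 * (((n : ℚ) + 2 - k) * ((n : ℚ) + 3 - k))) ^ 2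
          * (c * ((n : ℚ) + k + 1)) := by rw [e, h4]
    _ = a3 ^ 2 * c * (((n : ℚ) + 1) ^ 3 * ((n : ℚ) + 2) ^ 2
          * (((n : ℚ) + 2 - k) * ((n : ℚ) + 3 - k)) ^ 2 * ((n : ℚ) + 1 + k)) := by ring

/-- `Z(n)·s(n+2,k) = B(n,k)·(n+1)³(n+2)³(n+3-k)²(n+1+k)(n+2+k)`. -/
theorem Zn_outerS_two (n k : ℕ) :
    Zn n * outerS (n + 2) k = base n k *
      (((n : ℚ) + 1) ^ 3 * ((n : ℚ) + 2) ^ 3 * ((n : ℚ) + 3 - k) ^ 2 * ((n : ℚ) + 1 + k) * ((n : ℚ) + 2 + k)) := by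
  have h3 := choose_succ_left_cast (n + 2) k
  have h4 := choose_add_succ_left_cast n k
  have h5 := choose_add_succ_left_cast (n + 1) k
  unfold Zn outerS base
  push_cast at h3 h4 h5 ⊢
  rw [show n + 2 + k = n + 1 + 1 + k from rfl]
  set a2 := (((n + 2).choose k : ℕ) : ℚ)
  set a3 := (((n + 3).choose k : ℕ) : ℚ)
  set c := (((n + k).choose n : ℕ) : ℚ)
  set c1 := (((n + 1 + k).choose (n + 1) : ℕ) : ℚ)
  set c2 := (((n + 1 + 1 + k).choose (n + 1 + 1) : ℕ) : ℚ)
  calc ((n : ℚ) + 1) ^ 4 * ((n : ℚ) + 2) ^ 4 * ((n : ℚ) + 3) ^ 2 * (a2 ^ 2 * c2)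
      = ((n : ℚ) + 1) ^ 3 * ((n : ℚ) + 2) ^ 3 * (a2 * ((n : ℚ) + 2 + 1)) ^ 2
          * ((c2 * ((n : ℚ) + 1 + 1)) * ((n : ℚ) + 1)) := by ring
    _ = ((n : ℚ) + 1) ^ 3 * ((n : ℚ) + 2) ^ 3 * (a3 * ((n : ℚ) + 2 + 1 - k)) ^ 2
          * ((c1 * ((n : ℚ) + 1 + k + 1)) * ((n : ℚ) + 1)) := by rw [h3, h5]
    _ = ((n : ℚ) + 1) ^ 3 * ((n : ℚ) + 2) ^ 3 * (a3 * ((n : ℚ) + 2 + 1 - k)) ^ 2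
          * ((c1 * ((n : ℚ) + 1)) * ((n : ℚ) + 1 + k + 1)) := by ring
    _ = ((n : ℚ) + 1) ^ 3 * ((n : ℚ) + 2) ^ 3 * (a3 * ((n : ℚ) + 2 + 1 - k)) ^ 2
          * ((c * ((n : ℚ) + k + 1)) * ((n : ℚ) + 1 + k + 1)) := by rw [h4]
    _ = a3 ^ 2 * c * (((n : ℚ) + 1) ^ 3 * ((n : ℚ) + 2) ^ 3 * ((n : ℚ) + 3 - k) ^ 2
          * ((n : ℚ) + 1 + k) * ((n : ℚ) + 2 + k)) := by ring

/-- `Z(n)·s(n+3,k) = B(n,k)·(n+1)³(n+2)³(n+3)(n+k+1)(n+k+2)(n+k+3)`. -/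
theorem Zn_outerS_three (n k : ℕ) :
    Zn n * outerS (n + 3) k = base n k *
      (((n : ℚ) + 1) ^ 3 * ((n : ℚ) + 2) ^ 3 * ((n : ℚ) + 3) * ((n : ℚ) + k + 1) * ((n : ℚ) + k + 2)
        * ((n : ℚ) + k + 3)) := by
  have h4 := choose_add_succ_left_cast n k
  have h5 := choose_add_succ_left_cast (n + 1) k
  have h6 := choose_add_succ_left_cast (n + 2) k
  unfold Zn outerS base
  push_cast at h4 h5 h6 ⊢
  rw [show n + 3 + k = n + 2 + 1 + k from rfl, show n + 3 = n + 2 + 1 from rfl, show n + 2 = n + 1 + 1 from rfl]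
  set a3 := (((n + 1 + 1 + 1).choose k : ℕ) : ℚ)
  set c := (((n + k).choose n : ℕ) : ℚ)
  set c1 := (((n + 1 + k).choose (n + 1) : ℕ) : ℚ)
  set c2 := (((n + 1 + 1 + k).choose (n + 1 + 1) : ℕ) : ℚ)
  set c3 := (((n + 1 + 1 + 1 + k).choose (n + 1 + 1 + 1) : ℕ) : ℚ)
  calc ((n : ℚ) + 1) ^ 4 * ((n : ℚ) + 2) ^ 4 * ((n : ℚ) + 3) ^ 2 * (a3 ^ 2 * c3)
      = ((n : ℚ) + 1) ^ 3 * ((n : ℚ) + 2) ^ 3 * ((n : ℚ) + 3) * a3 ^ 2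
          * ((c3 * ((n : ℚ) + 2 + 1)) * ((n : ℚ) + 1 + 1) * ((n : ℚ) + 1)) := by ring
    _ = ((n : ℚ) + 1) ^ 3 * ((n : ℚ) + 2) ^ 3 * ((n : ℚ) + 3) * a3 ^ 2
          * ((c2 * ((n : ℚ) + 2 + k + 1)) * ((n : ℚ) + 1 + 1) * ((n : ℚ) + 1)) := by rw [h6]
    _ = ((n : ℚ) + 1) ^ 3 * ((n : ℚ) + 2) ^ 3 * ((n : ℚ) + 3) * a3 ^ 2
          * ((c2 * ((n : ℚ) + 1 + 1)) * ((n : ℚ) + 1 + 1 + k + 1) * ((n : ℚ) + 1)) := by ring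
    _ = ((n : ℚ) + 1) ^ 3 * ((n : ℚ) + 2) ^ 3 * ((n : ℚ) + 3) * a3 ^ 2
          * ((c1 * ((n : ℚ) + 1 + k + 1)) * ((n : ℚ) + 1 + 1 + k + 1) * ((n : ℚ) + 1)) := by rw [h5]
    _ = ((n : ℚ) + 1) ^ 3 * ((n : ℚ) + 2) ^ 3 * ((n : ℚ) + 3) * a3 ^ 2
          * ((c1 * ((n : ℚ) + 1)) * ((n : ℚ) + 1 + k + 1) * ((n : ℚ) + 1 + 1 + k + 1)) := by ring
    _ = ((n : ℚ) + 1) ^ 3 * ((n : ℚ) + 2) ^ 3 * ((n : ℚ) + 3) * a3 ^ 2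
          * ((c * ((n : ℚ) + k + 1)) * ((n : ℚ) + 1 + k + 1) * ((n : ℚ) + 1 + 1 + k + 1)) := by rw [h4]
    _ = a3 ^ 2 * c * (((n : ℚ) + 1) ^ 3 * ((n : ℚ) + 2) ^ 3 * ((n : ℚ) + 3) * ((n : ℚ) + k + 1)
          * ((n : ℚ) + k + 2) * ((n : ℚ) + k + 3)) := by ring

/-- Base shift: `B(n,k+1)·(k+1)³ = B(n,k)·(n+3-k)²(n+k+1)`. -/
theorem base_succ (n k : ℕ) :
    base n (k + 1) * ((k : ℚ) + 1) ^ 3 = base n k * (((n : ℚ) + 3 - k) ^ 2 * ((n : ℚ) + k + 1)) := by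
  have h1 := choose_succ_right_cast (n + 3) k
  have h2 := choose_add_succ_right_cast n k
  unfold base
  push_cast at h1 h2 ⊢
  rw [show n + (k + 1) = n + (k + 1) from rfl]
  set a := (((n + 3).choose (k + 1) : ℕ) : ℚ)
  set a' := (((n + 3).choose k : ℕ) : ℚ)
  set c := (((n + (k + 1)).choose n : ℕ) : ℚ)
  set c' := (((n + k).choose n : ℕ) : ℚ)
  calc a ^ 2 * c * ((k : ℚ) + 1) ^ 3 = (a * ((k : ℚ) + 1)) ^ 2 * (c * ((k : ℚ) + 1)) := by ring
    _ = (a' * ((n : ℚ) + 3 - k)) ^ 2 * (c' * ((n : ℚ) + k + 1)) := by rw [h1, h2]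
    _ = a' ^ 2 * c' * (((n : ℚ) + 3 - k) ^ 2 * ((n : ℚ) + k + 1)) := by ring

/-! ### The telescoping identity of the outer sum -/

/-- The certificate identity with all weights divided by `B(n,k)`: a polynomial combination of the
ten values `T(n+i,k+j)` vanishes, being a combination (`atom_ij`) of the relations (K), (N). -/
theorem bracket_zero (n k : ℕ) :
    ((k : ℚ) + 1) ^ 3 *
        (C0 n * (((n : ℚ) + 1) ^ 2 * ((n : ℚ) + 2) ^ 2
            * (((n : ℚ) + 1 - k) * ((n : ℚ) + 2 - k) * ((n : ℚ) + 3 - k)) ^ 2) * innerT n k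
          + C1 n * (((n : ℚ) + 1) ^ 3 * ((n : ℚ) + 2) ^ 2 * (((n : ℚ) + 2 - k) * ((n : ℚ) + 3 - k)) ^ 2
            * ((n : ℚ) + 1 + k)) * innerT (n + 1) k
          + C2 n * (((n : ℚ) + 1) ^ 3 * ((n : ℚ) + 2) ^ 3 * ((n : ℚ) + 3 - k) ^ 2 * ((n : ℚ) + 1 + k)
            * ((n : ℚ) + 2 + k)) * innerT (n + 2) k
          + C3 n * (((n : ℚ) + 1) ^ 3 * ((n : ℚ) + 2) ^ 3 * ((n : ℚ) + 3) * ((n : ℚ) + k + 1)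
            * ((n : ℚ) + k + 2) * ((n : ℚ) + k + 3)) * innerT (n + 3) k)
      + ((k : ℚ) + 1) ^ 3 * (gc0 n k * innerT n k + gc1 n k * innerT n (k + 1) + gc2 n k * innerT n (k + 2))
      - ((n : ℚ) + 3 - k) ^ 2 * ((n : ℚ) + k + 1)
          * (gc0 n ((k : ℚ) + 1) * innerT n (k + 1) + gc1 n ((k : ℚ) + 1) * innerT n (k + 2)
            + gc2 n ((k : ℚ) + 1) * innerT n (k + 3)) = 0 := by
  have hK0 := relK n k
  have hK1 := relK n (k + 1)
  have hN00 := relN n k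
  have hN01 := relN n (k + 1)
  have hN02 := relN n (k + 2)
  have hN10 := relN (n + 1) k
  have hN11 := relN (n + 1) (k + 1)
  have hN20 := relN (n + 2) k
  simp only [Nat.cast_add, Nat.cast_one, Nat.cast_ofNat, e₁, qN] at hK0 hK1 hN00 hN01 hN02 hN10 hN11 hN20
  simp only [show k + 1 + 1 = k + 2 from rfl, show k + 1 + 2 = k + 3 from rfl,
    show n + 1 + 1 = n + 2 from rfl, show n + 2 + 1 = n + 3 from rfl] at hK1 hN01 hN02 hN10 hN11 hN20
  linear_combination innerT n k * atom_00 (n : ℚ) (k : ℚ) + innerT n (k + 1) * atom_01 (n : ℚ) (k : ℚ)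
    + innerT n (k + 2) * atom_02 (n : ℚ) (k : ℚ) + innerT n (k + 3) * atom_03 (n : ℚ) (k : ℚ)
    + innerT (n + 1) k * atom_10 (n : ℚ) (k : ℚ) + innerT (n + 1) (k + 1) * atom_11 (n : ℚ) (k : ℚ)
    + innerT (n + 1) (k + 2) * atom_12 (n : ℚ) (k : ℚ) + innerT (n + 2) k * atom_20 (n : ℚ) (k : ℚ)
    + innerT (n + 2) (k + 1) * atom_21 (n : ℚ) (k : ℚ) + innerT (n + 3) k * atom_30 (n : ℚ) (k : ℚ)
    + (((k : ℚ) + 1) ^ 3 * lam n k) * hK0 + (((k : ℚ) + 1) ^ 3 * mu n k) * hK1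
    + (((k : ℚ) + 1) ^ 3 * nu0 n k) * hN00 + (((k : ℚ) + 1) ^ 3 * nu1 n k) * hN01
    + (((k : ℚ) + 1) ^ 3 * nu2 n k) * hN02 + (((k : ℚ) + 1) ^ 3 * nu3 n k) * hN10
    + (((k : ℚ) + 1) ^ 3 * nu4 n k) * hN11 + (((k : ℚ) + 1) ^ 3 * nu5 n k) * hN20

/-- The summand of the outer telescoping: `Σ_i C_i(n) s(n+i,k) T(n+i,k)`. -/
noncomputable def outerTerm (n k : ℕ) : ℚ :=
  C0 n * outerS n k * innerT n k + C1 n * outerS (n + 1) k * innerT (n + 1) k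
    + C2 n * outerS (n + 2) k * innerT (n + 2) k + C3 n * outerS (n + 3) k * innerT (n + 3) k

/-- **Pointwise telescoping**: `Z(n)·Σ_i C_i(n) s(n+i,k) T(n+i,k) = Z(n)·(G(n,k+1) - G(n,k))`. -/
theorem telescope_point (n k : ℕ) : Zn n * outerTerm n k = Zn n * (certG n (k + 1) - certG n k) := by
  have hZ := Zn_ne_zero n
  have hk : ((k : ℚ) + 1) ^ 3 ≠ 0 := by positivity
  have eG0 : Zn n * certG n k
      = base n k * (gc0 n k * innerT n k + gc1 n k * innerT n (k + 1) + gc2 n k * innerT n (k + 2)) := by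
    unfold certG; field_simp
  have eG1 : Zn n * certG n (k + 1) = base n (k + 1) * (gc0 n ((k : ℚ) + 1) * innerT n (k + 1)
      + gc1 n ((k : ℚ) + 1) * innerT n (k + 2) + gc2 n ((k : ℚ) + 1) * innerT n (k + 3)) := by
    unfold certG; push_cast; field_simp
  have hS0 := Zn_outerS_zero n k
  have hS1 := Zn_outerS_one n k
  have hS2 := Zn_outerS_two n k
  have hS3 := Zn_outerS_three n k
  have hB := base_succ n k
  have hbr := bracket_zero n k
  apply mul_right_cancel₀ hk
  unfold outerTerm
  linear_combination (((k : ℚ) + 1) ^ 3 * (C0 n * innerT n k)) * hS0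
    + (((k : ℚ) + 1) ^ 3 * (C1 n * innerT (n + 1) k)) * hS1
    + (((k : ℚ) + 1) ^ 3 * (C2 n * innerT (n + 2) k)) * hS2
    + (((k : ℚ) + 1) ^ 3 * (C3 n * innerT (n + 3) k)) * hS3
    + (-((k : ℚ) + 1) ^ 3) * eG1 + (((k : ℚ) + 1) ^ 3) * eG0
    + (-(gc0 n ((k : ℚ) + 1) * innerT n (k + 1) + gc1 n ((k : ℚ) + 1) * innerT n (k + 2)
        + gc2 n ((k : ℚ) + 1) * innerT n (k + 3))) * hB
    + base n k * hbr

/-- Boundary values of the certificate: `G(n,0) = 0` (factor `k³`) … -/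
theorem certG_zero (n : ℕ) : certG n 0 = 0 := by
  simp [certG, gc0, gc1, gc2]

/-- … and `G(n,n+4) = 0` (the base `C(n+3,n+4)² = 0`). -/
theorem certG_top (n : ℕ) : certG n (n + 4) = 0 := by
  simp [certG, base]

/-- **The outer sum telescopes to zero**: `Σ_{k ≤ n+3} Σ_i C_i(n) s(n+i,k) T(n+i,k) = 0`. -/
theorem sum_outerTerm (n : ℕ) : ∑ k ∈ range (n + 4), outerTerm n k = 0 := by
  have hZ := Zn_ne_zero n
  have h : Zn n * ∑ k ∈ range (n + 4), outerTerm n k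
      = Zn n * ∑ k ∈ range (n + 4), (certG n (k + 1) - certG n k) := by
    rw [Finset.mul_sum, Finset.mul_sum]
    exact Finset.sum_congr rfl fun k _ => telescope_point n k
  rw [Finset.sum_range_sub, certG_top, certG_zero, sub_zero, mul_zero] at h
  rcases mul_eq_zero.mp h with h' | h'
  · exact absurd h' hZ
  · exact h'

/-! ### From the telescoping identity to the recursion for `Q_n` -/

/-- `Q_m` (Brown–Zudilin (7), a natural number in the tree) as the rational double sum `Σ_k s(m,k) T(m,k)`. -/
theorem cast_Q (m : ℕ) : ((Q m : ℕ) : ℚ) = ∑ k ∈ range (m + 1), outerS m k * innerT m k := by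
  simp only [Q, Nat.cast_sum, Nat.cast_mul, Nat.cast_pow, outerS, innerT, innerTerm, Finset.mul_sum]
  refine Finset.sum_congr rfl fun k _ => Finset.sum_congr rfl fun j _ => ?_
  ring

/-- Truncation: for `m ≤ n+3`, `Σ_{k ≤ n+3} s(m,k) T(m,k) = Σ_{k ≤ m} s(m,k) T(m,k) = Q_m`. -/
theorem sum_outerS_innerT (m n : ℕ) (h : m ≤ n + 3) :
    ∑ k ∈ range (n + 4), outerS m k * innerT m k = ((Q m : ℕ) : ℚ) := by
  rw [cast_Q]
  symm
  apply Finset.sum_subset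
  · intro k hk
    simp only [Finset.mem_range] at hk ⊢
    omega
  · intro k _ hk
    simp only [Finset.mem_range, not_lt] at hk
    simp [outerS, Nat.choose_eq_zero_of_lt (by omega : m < k)]

/-- **The recursion at index `n+2`** in telescoper form:
`C0(n) Q_n + C1(n) Q_{n+1} + C2(n) Q_{n+2} + C3(n) Q_{n+3} = 0`. -/
theorem rec_shifted (n : ℕ) :
    C0 n * ((Q n : ℕ) : ℚ) + C1 n * ((Q (n + 1) : ℕ) : ℚ) + C2 n * ((Q (n + 2) : ℕ) : ℚ)
      + C3 n * ((Q (n + 3) : ℕ) : ℚ) = 0 := by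
  have h := sum_outerTerm n
  simp only [outerTerm, Finset.sum_add_distrib, mul_assoc, ← Finset.mul_sum] at h
  rwa [sum_outerS_innerT n n (by omega), sum_outerS_innerT (n + 1) n (by omega),
    sum_outerS_innerT (n + 2) n (by omega), sum_outerS_innerT (n + 3) n (by omega)] at h

/-- The telescoper is the Brown–Zudilin recursion shifted by two: `C0(n) = c₀(n+2)`. -/
theorem C0_eq (n : ℚ) : C0 n = c₀ (n + 2) := by unfold C0 c₀; ring
/-- `C1(n) = -c₁(n+2)`. -/
theorem C1_eq (n : ℚ) : C1 n = -c₁ (n + 2) := by unfold C1 c₁; ring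
/-- `C2(n) = -c₂(n+2)`. -/
theorem C2_eq (n : ℚ) : C2 n = -c₂ (n + 2) := by unfold C2 c₂; ring
/-- `C3(n) = c₃(n+2)`. -/
theorem C3_eq (n : ℚ) : C3 n = c₃ (n + 2) := by unfold C3 c₃; ring

/-- **Brown–Zudilin's recursion for the double binomial sum (7), all `n ≥ 2`** — the named fact
`Literature.NumberTheory.Irrationality.BrownZudilin2022.Q_solvesRec` DISCHARGED:
`c₃(n) Q_{n+1} - c₂(n) Q_n - c₁(n) Q_{n-1} + c₀(n) Q_{n-2} = 0`. -/
theorem Q_solvesRec_holds : Q_solvesRec := by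
  intro n hn
  obtain ⟨m, rfl⟩ : ∃ m, n = m + 2 := ⟨n - 2, by omega⟩
  have h := rec_shifted m
  rw [C0_eq, C1_eq, C2_eq, C3_eq] at h
  simp only [show m + 2 + 1 = m + 3 by omega, show m + 2 - 1 = m + 1 by omega, Nat.add_sub_cancel]
  push_cast
  linear_combination h

end Summit.KontsevichZagierPeriods.Zeta5Search.SymmetricRecursion
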